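import Mathlib.Analysis.Analytic.Basic
import Mathlib.Analysis.SpecialFunctions.Pow.Real
import Literature.ModelTheory.ExponentialFields.CylindricalDecomposition
import HarnessLib

/-!
# Lion–Rolin preparation for `ℚ`-semialgebraic functions (Kaiser 2024, Def. 3.10, Thm. 3.11)

Topic `Literature/ModelTheory/ExponentialFields` (next to `CylindricalDecomposition.lean`, whose
vocabulary of cells — `IsCylindricalDecomposition`, `graphOver`, `bandOver` — is reused).

## What is printed

T. Kaiser, *Periods, power series, and integrated algebraic numbers*, Math. Ann. 390 (2024)
(arXiv:2211.01269), **Definition 3.10 (Lion–Rolin Preparation).** "We say that `𝒮̃` has Lion–Rolin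
preparation if the following holds. Let `A ⊂ 𝕜ⁿ` be definable in `𝒮̃` and let
`f : A → 𝕜, (x', xₙ) ↦ f(x', xₙ)`, be a definable function. Then there is a cell decomposition `𝒞`
of `A` such that the following holds. Let `C ∈ 𝒞` and let `B` denote the base of `C` … Assume that
`C` is fat with respect to the last variable `xₙ`; i.e. `C_{x'}` is a nonempty open interval (and not
just a point) for every `x' ∈ B`. Then the function `f|_C` can be written as
`f|_C(x', xₙ) = a(x') |xₙ − θ(x')|^r u(x', xₙ − θ(x'))` where `r ∈ ℚ`, the functions `a, θ : B → 𝕜`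
are definable in `𝒮̃`, `xₙ ≠ θ(x')` on `C`, and `u(x', xₙ)` is a so-called special unit on
`C^θ := {(x', xₙ − θ(x')) | (x', xₙ) ∈ C}`; i.e. `u` is of the form
`u(x', xₙ) = v(b₁(x'), …, b_M(x'), b_{M+1}(x') |xₙ|^{1/q}, b_{M+2}(x') |xₙ|^{-1/q})` where `q ∈ ℕ`,
`φ : B × ℝ ∖ {0} → ℝ^{M+2}, (x', xₙ) ↦ (b₁(x'), …, b_{M+2}(x') |y|^{-1/q})` is a definable and real
analytic function with `φ(C^θ) ⊂ [−1, 1]^{M+2}` and `v ∈ R𝒮_{M+2}` with `v([−1, 1]^{M+2}) ⊂ [1/c, c]`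
for some `c ∈ 𝕜` with `c > 1`."  **Theorem 3.11.** "The structure `𝒮̃` has Lion–Rolin preparation."
Here `𝒮` is any convergent Weierstraß system with coefficient field `𝕜` (loc. cit. Def. 1.10) and
`R𝒮_m` is the algebra of *restricted `𝒮`-functions*: `p ∈ 𝒮_m` converging on a neighbourhood of the
unit cube `[−1, 1]^m`, extended by `0` off the cube (Def. 3.1).

## The instance vendored here

The smallest convergent Weierstraß system is the system `𝒜` of *algebraic power series* (power
series algebraic over `ℚ[X]`), with coefficient field the real algebraic numbers `𝔸` (loc. cit.
Example 1.8, Cor. 1.17); "`𝒜̃` is the pure field structure `𝔸̃`, the definable sets are the sets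
semialgebraic over the rationals" (loc. cit. §5, first lines; "semialgebraic over `𝔸` (or
equivalently over `ℚ`)", Def. 5.3). The preparation statement is a first-order property of the
`L_𝒜^ℚ`-structure and is read in the real model `ℝ𝒜̃` — the canonical lifting of `𝒜̃`-definable sets
and functions to `ℝ`, `φ(𝕜)_ℝ = φ(ℝ)` (loc. cit. Prop. 3.5, §4 and Example 4.1 (1); the lifting is
that of [BochnakCosteRoy1998, Ch. 5]). In `ℝ𝒜̃` a restricted `𝒜`-function of arity `m` is, on a
neighbourhood of `[−1, 1]^m`, the sum of an algebraic power series with real algebraic coefficients: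
a real-analytic function which is Nash — semialgebraic — over `𝔸`, equivalently over `ℚ`, on that
neighbourhood (loc. cit. Example 1.8 (1): "Given `f ∈ 𝒩ₙ(𝕜)` the associated real analytic function
is Nash over `𝕜` on its domain of convergence"). The cells of an `𝒜̃`-cell decomposition lift to the
cells of a cylindrical decomposition of `ℝⁿ` with `ℚ`-semialgebraic cells and continuous
`ℚ`-semialgebraic sections (`IsCylindricalDecomposition ℚ`, [BasuPollackRoy2006, Def. 5.1] =
[Dries1998, Ch. 3 (2.10)]), "cell decomposition of `A`" meaning that every cell lies in `A` or
misses `A`; the fat cells are the bands `bandOver`.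

So `semialgebraicPreparation` below states: for a `ℚ`-semialgebraic `A ⊆ ℝⁿ⁺¹` and a function `f`
`ℚ`-semialgebraic on `A` there is a cylindrical decomposition of `ℝⁿ` over `ℚ` with continuous
`ℚ`-semialgebraic sections over its cells whose graphs and bands each lie in `A` or miss `A`, such
that on every band `T ⊆ A` over a cell `S`, `f` is Lion–Rolin prepared (`IsLRPreparedOn`): 
`f(x', y) = a(x') |y − θ(x')|^r v(b₁(x'), …, b_M(x'), b_{M+1}(x') |y − θ(x')|^{1/q},
b_{M+2}(x') |y − θ(x')|^{-1/q})` with `a, θ, bᵢ` `ℚ`-semialgebraic on `S`, `y ≠ θ(x')` on `T`, the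
arguments of `v` in `[−1, 1]^{M+2}` on `T`, and `v` real-analytic and `ℚ`-semialgebraic on an open
box `(−1−δ, 1+δ)^{M+2}` with values in `[c⁻¹, c]` on the closed cube (`c > 1`). Dropped from the
printed statement (so the vendored statement is weaker): analyticity of `φ` and of the cells, and
`c ∈ 𝕜`.

This is the preparation theorem of [LionRolin1997, Thm. 1] (globally subanalytic functions; the
"unité réduite" `U = V ∘ ψ` of loc. cit. §0.3) in the form of [Kaiser2013] for semialgebraic
functions, with the bookkeeping of the field of definition of [Kaiser2022]; see also van den
Dries–Speissegger, *O-minimal preparation theorems* (2002). It is the two-variable input of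
class-level Comte–Lion–Rolin expansions of parametric integrals of `ℚ`-semialgebraic families
[ComteLionRolin2000] (route KontsevichZagierPeriods/ValuedFieldSpecialisation, items
`ClassLevelExpansion(FibreDimOne)`).

## What is NOT here

No proof: the printed proof goes through quantifier elimination and universal axiomatisation of
`𝒜̃` (loc. cit. Thm. 3.2, 3.6), Weierstraß preparation in `𝒜` and [LionRolin1997, Prop. 2];
theory-sized. Named fact only (`def … : Prop`).

## References

* [Kaiser2022] T. Kaiser, *Periods, power series, and integrated algebraic numbers*, Math. Ann. 390
  (2024) 2043–2074, arXiv:2211.01269: Def. 1.10, Example 1.8, Cor. 1.17, Def. 3.1, Prop. 3.5,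
  Def. 3.10, Thm. 3.11, Example 4.1 (1), §5 (read in the arXiv version, pp. 5–7, 12–13, 15–16).
* [LionRolin1997] J.-M. Lion, J.-P. Rolin, *Théorème de préparation pour les fonctions
  logarithmico-exponentielles*, Ann. Inst. Fourier 47 (1997) 859–884: §0.3–0.4, Thm. 1 (pp. 861–863).
* [Kaiser2013] T. Kaiser, *Integration of semialgebraic functions and integrated Nash functions*,
  Math. Z. 275 (2013) 349–366.
* [ComteLionRolin2000] G. Comte, J.-M. Lion, J.-P. Rolin, *Nature log-analytique du volume des
  sous-analytiques*, Illinois J. Math. 44 (2000) 884–888.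
* [BochnakCosteRoy1998] J. Bochnak, M. Coste, M.-F. Roy, *Real Algebraic Geometry* (1998), Ch. 5, 8.
-/

noncomputable section

open Set
open Literature.NumberTheory.Transcendental (IsSemialgebraicFunOn)

namespace Literature.ModelTheory.ExponentialFields

variable {n : ℕ}

/-- The arguments of the special unit of a Lion–Rolin prepared function [Kaiser2022, Def. 3.10]:
`φ(x', t) = (b₁(x'), …, b_M(x'), b_{M+1}(x') |t|^{1/q}, b_{M+2}(x') |t|^{-1/q}) ∈ ℝ^{M+2}`, where
`t = y − θ(x')` is the last coordinate recentred at `θ`; here `z = (x', y) ∈ ℝⁿ⁺¹`,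
`x' = Fin.init z`, `y = z (Fin.last n)`. [cite: Kaiser2022, Def. 3.10] -/
def lrUnitArgs {M : ℕ} (q : ℕ) (θ : (Fin n → ℝ) → ℝ) (b : Fin M → (Fin n → ℝ) → ℝ)
    (b₁ b₂ : (Fin n → ℝ) → ℝ) (z : Fin (n + 1) → ℝ) : Fin (M + 2) → ℝ :=
  Fin.append (fun i => b i (Fin.init z))
    ![b₁ (Fin.init z) * |z (Fin.last n) - θ (Fin.init z)| ^ ((1 : ℝ) / q),
      b₂ (Fin.init z) * |z (Fin.last n) - θ (Fin.init z)| ^ (-(1 : ℝ) / q)]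

/-- **Lion–Rolin prepared form of `f` on a band `T` over the base cell `S`** with `ℚ`-semialgebraic
data [Kaiser2022, Def. 3.10, for the system `𝒜` of algebraic power series, read in the real model]:
`f(x', y) = a(x') · |y − θ(x')|^r · v(φ(x', y − θ(x')))` on `T`, where `r ∈ ℚ`, `0 < q`, `a`, `θ`,
`b₁, …, b_{M+2}` are `ℚ`-semialgebraic on `S`, `y ≠ θ(x')` on `T`, the unit arguments `lrUnitArgs`
lie in the closed cube `[−1, 1]^{M+2}` on `T`, and the *special unit* `v` is real-analytic and
`ℚ`-semialgebraic (Nash over the real algebraic numbers) on an open box `(−1−δ, 1+δ)^{M+2}` around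
the closed cube, on which it takes values in `[c⁻¹, c]`, `c > 1` (a restricted algebraic power
series, loc. cit. Def. 3.1, Example 1.8 (1)). [cite: Kaiser2022, Def. 3.10] -/
def IsLRPreparedOn (S : Set (Fin n → ℝ)) (T : Set (Fin (n + 1) → ℝ)) (f : (Fin (n + 1) → ℝ) → ℝ) :
    Prop :=
  ∃ (r : ℚ) (q M : ℕ) (c : ℝ) (δ : ℚ) (a θ : (Fin n → ℝ) → ℝ) (b : Fin M → (Fin n → ℝ) → ℝ)
    (b₁ b₂ : (Fin n → ℝ) → ℝ) (v : (Fin (M + 2) → ℝ) → ℝ),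
    0 < q ∧ 1 < c ∧ 0 < δ ∧
    IsSemialgebraicFunOn ℚ S a ∧ IsSemialgebraicFunOn ℚ S θ ∧ (∀ i, IsSemialgebraicFunOn ℚ S (b i)) ∧
    IsSemialgebraicFunOn ℚ S b₁ ∧ IsSemialgebraicFunOn ℚ S b₂ ∧
    (∀ z ∈ T, z (Fin.last n) ≠ θ (Fin.init z)) ∧
    IsSemialgebraicFunOn ℚ (Set.pi univ fun _ => Ioo (-(1 + δ) : ℝ) (1 + δ)) v ∧
    AnalyticOnNhd ℝ v (Set.pi univ fun _ => Ioo (-(1 + δ) : ℝ) (1 + δ)) ∧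
    (∀ w ∈ Set.pi univ fun _ : Fin (M + 2) => Icc (-1 : ℝ) 1, c⁻¹ ≤ v w ∧ v w ≤ c) ∧
    (∀ z ∈ T, lrUnitArgs q θ b b₁ b₂ z ∈ Set.pi univ fun _ : Fin (M + 2) => Icc (-1 : ℝ) 1) ∧
    ∀ z ∈ T, f z = a (Fin.init z) * |z (Fin.last n) - θ (Fin.init z)| ^ (r : ℝ) *
      v (lrUnitArgs q θ b b₁ b₂ z)

/-- **Lion–Rolin preparation of `ℚ`-semialgebraic functions** [Kaiser2022, Thm. 3.11 with
Def. 3.10, for the convergent Weierstraß system `𝒜` of algebraic power series (Example 1.8,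
Cor. 1.17), whose definable sets are the sets semialgebraic over `ℚ` (§5), read in the real model
`ℝ𝒜̃` by the canonical lifting `φ(𝕜)_ℝ = φ(ℝ)` (Prop. 3.5, Example 4.1 (1))]; originally
[LionRolin1997, Thm. 1] for globally subanalytic functions. For every `ℚ`-semialgebraic
`A ⊆ ℝⁿ⁺¹` and every `f` `ℚ`-semialgebraic on `A` there are a cylindrical decomposition `𝒮` of `ℝⁿ`
over `ℚ` and, over each of its cells `S`, continuous `ℚ`-semialgebraic sections
`ξ_{S,0} < ⋯ < ξ_{S,ℓ_S−1}` (so that their graphs and bands form a cylindrical decomposition of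
`ℝⁿ⁺¹`, [BasuPollackRoy2006, Def. 5.1]) such that every graph and every band lies in `A` or misses
`A` (a cell decomposition of `A`), and `f` is Lion–Rolin prepared (`IsLRPreparedOn`) on every band
contained in `A` (the cells of the decomposition of `A` that are fat in the last variable). Named
fact, not proved here. [cite: Kaiser2022, Thm. 3.11] -/
def semialgebraicPreparation : Prop :=
  ∀ (n : ℕ) (A : Set (Fin (n + 1) → ℝ)) (f : (Fin (n + 1) → ℝ) → ℝ),
    IsSemialgebraic ℚ A → IsSemialgebraicFunOn ℚ A f →
    ∃ (𝒮 : Finset (Set (Fin n → ℝ))) (l : Set (Fin n → ℝ) → ℕ)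
      (ξ : (S : Set (Fin n → ℝ)) → Fin (l S) → (Fin n → ℝ) → ℝ),
      IsCylindricalDecomposition ℚ n 𝒮 ∧
      (∀ S ∈ 𝒮, ∀ j, ContinuousOn (ξ S j) S) ∧
      (∀ S ∈ 𝒮, ∀ j, IsSemialgebraicFunOn ℚ S (ξ S j)) ∧
      (∀ S ∈ 𝒮, ∀ x ∈ S, StrictMono fun j => ξ S j x) ∧
      (∀ S ∈ 𝒮, ∀ j, graphOver S (ξ S j) ⊆ A ∨ Disjoint (graphOver S (ξ S j)) A) ∧
      (∀ S ∈ 𝒮, ∀ j, bandOver S (ξ S) j ⊆ A ∨ Disjoint (bandOver S (ξ S) j) A) ∧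
      ∀ S ∈ 𝒮, ∀ j, bandOver S (ξ S) j ⊆ A → IsLRPreparedOn S (bandOver S (ξ S) j) f

/-- Unfolding `IsLRPreparedOn` (definitional). [cite: Kaiser2022, Def. 3.10] -/
theorem isLRPreparedOn_iff {S : Set (Fin n → ℝ)} {T : Set (Fin (n + 1) → ℝ)}
    {f : (Fin (n + 1) → ℝ) → ℝ} :
    IsLRPreparedOn S T f ↔
      ∃ (r : ℚ) (q M : ℕ) (c : ℝ) (δ : ℚ) (a θ : (Fin n → ℝ) → ℝ) (b : Fin M → (Fin n → ℝ) → ℝ)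
        (b₁ b₂ : (Fin n → ℝ) → ℝ) (v : (Fin (M + 2) → ℝ) → ℝ),
        0 < q ∧ 1 < c ∧ 0 < δ ∧
        IsSemialgebraicFunOn ℚ S a ∧ IsSemialgebraicFunOn ℚ S θ ∧
        (∀ i, IsSemialgebraicFunOn ℚ S (b i)) ∧
        IsSemialgebraicFunOn ℚ S b₁ ∧ IsSemialgebraicFunOn ℚ S b₂ ∧
        (∀ z ∈ T, z (Fin.last n) ≠ θ (Fin.init z)) ∧
        IsSemialgebraicFunOn ℚ (Set.pi univ fun _ => Ioo (-(1 + δ) : ℝ) (1 + δ)) v ∧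
        AnalyticOnNhd ℝ v (Set.pi univ fun _ => Ioo (-(1 + δ) : ℝ) (1 + δ)) ∧
        (∀ w ∈ Set.pi univ fun _ : Fin (M + 2) => Icc (-1 : ℝ) 1, c⁻¹ ≤ v w ∧ v w ≤ c) ∧
        (∀ z ∈ T, lrUnitArgs q θ b b₁ b₂ z ∈ Set.pi univ fun _ : Fin (M + 2) => Icc (-1 : ℝ) 1) ∧
        ∀ z ∈ T, f z = a (Fin.init z) * |z (Fin.last n) - θ (Fin.init z)| ^ (r : ℝ) *
          v (lrUnitArgs q θ b b₁ b₂ z) :=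
  Iff.rfl

/-- The prepared form restricts to sub-bands (same data). [cite: Kaiser2022, Def. 3.10] -/
theorem IsLRPreparedOn.mono {S : Set (Fin n → ℝ)} {T T' : Set (Fin (n + 1) → ℝ)}
    {f : (Fin (n + 1) → ℝ) → ℝ} (h : IsLRPreparedOn S T f) (hT : T' ⊆ T) : IsLRPreparedOn S T' f := by
  obtain ⟨r, q, M, c, δ, a, θ, b, b₁, b₂, v, hq, hc, hδ, ha, hθ, hb, hb₁, hb₂, hne, hvsa, hvan, hvc,
    hcube, hf⟩ := h
  exact ⟨r, q, M, c, δ, a, θ, b, b₁, b₂, v, hq, hc, hδ, ha, hθ, hb, hb₁, hb₂, fun z hz => hne z (hT hz),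
    hvsa, hvan, hvc, fun z hz => hcube z (hT hz), fun z hz => hf z (hT hz)⟩

end Literature.ModelTheory.ExponentialFields
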